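import Literature.MathematicalPhysics.QuantumFieldTheory.Balaban1983to89.B8Eq133Hypotheses
import Literature.MathematicalPhysics.QuantumFieldTheory.Balaban1983to89.B8Eq137QjEqB
import Literature.MathematicalPhysics.QuantumFieldTheory.Balaban1983to89.B8Eq143PlaqExpansion
import Literature.MathematicalPhysics.QuantumFieldTheory.Balaban1983to89.B8Eq127LandauGauge
import Literature.MathematicalPhysics.QuantumFieldTheory.Balaban1983to89.B8Eq110UnitaryProof
import Literature.MathematicalPhysics.QuantumFieldTheory.Balaban1983to89.B8Eq134Admissible
import Literature.MathematicalPhysics.QuantumFieldTheory.Balaban1983to89.B6SectADomainsV1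

/-!
# `Balaban1983to89.B8Carve01SpacesHyp` — [B8] Sects. A–C pp. 75–82 (displays (0.1)–(0.4), (1.1)–(1.39), Lemma 1):
# the CARVED hypothesis-form block file — every in-tree declaration of the section CITED BY NAME (machine-checked
# `recall` index), the two residual printed statements with no row typed AND proved (p. 78 «They form a subgroup …»,
# (1.32) the `𝔄_k`-clause of the image set `Σ_k`), and ONE bundle `Hyp` keyed to the consumer, discharged (`hyp_holds`)

statement-level skeleton of published theorems with citation tags; proofs where landed; nothing here is a claim about
the Yang–Mills mass gap

CITATION HEADER (lean-in-tree rule 2026-08-18).  T. Bałaban, *Spaces of regular gauge field configurations on a lattice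
and gauge fixing conditions*, Commun. Math. Phys. **99** (1985) 75–102 `[Balaban1985RegularSpaces]` ("B8"; "[3]" =
`[Balaban1985Averaging]`, "[4]" = `[Balaban1985BackgroundPropagators]`).  PDF held as text:
`paper:balaban1985-cmp99-regular-spaces-gauge-fixing` (journal page = PDF page + 74), pp. 75–82 [PDF 1–8] read on the
text layer this session (`p0001.txt`–`p0008.txt`) AND, for every sentence quoted below, AS IMAGES on the ×2 renders
`run/shared/lean/pub/pub-balaban/b2b-balaban-ref1/pages/1985-cmp99-regular-spaces-gauge-fixing/
1985-cmp99-regular-spaces-gauge-fixing-p001-x2.png` (p. 75), `-p004-x2.png` (p. 78), `-p007-x2.png` (p. 81), `-p008-x2.png`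
(p. 82).  Cell `lit-balaban` (HOME `run/shared/lean/pub/lit-balaban/`), P6 CARVING FAN
(D-0154 (3b)), seat `lit-balaban-carve-01` = BLOCK 01 of `carve/BLOCKS-01-10.md` (lead g29, SKELETON v3.365; rules
`carve/CARVE-RULES.md`): source section = B8 pp. 75–82, 27 SKELETON rows `B8.Lem1 … B8.Eq1.12-4`, ALL with a landed
declaration (proved-existing 15, proved 7, typed 1, typed-existing 4); KEY item `stmt-QuantumFields-20542` (K1⁷, lane
N05 [B8]), also-feeds `stmt-QuantumFields-19200`.  Filed `--supports stmt-QuantumFields-20542 --as helper`; it closes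
no item and moves no node count.

## THE PRINTED TEXT USED HERE (verbatim)

p. 75 [PDF 1]: *"|U(∂p) − 1| < α₀η², η = L⁻ᵏ (0.1) for α₀ sufficiently small and for plaquettes p contained in a
subdomain Ω ⊂ ηZᵈ. … The regularity conditions (0.1) are the most fundamental conditions we impose on gauge field
configurations. They are invariant with respect to gauge transformations U(x, x′) → Uᵘ(x, x′) = u(x)U(x, x′)u⁻¹(x′),
(0.2) so the space of configurations satisfying (0.1) is decomposed into a union of orbits determined by the group of
all gauge transformations."*
p. 78 [PDF 4]: *"hence the set 𝔅_k(𝔅_k, V) is invariant with respect to gauge transformations u satisfying the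
conditions u(y) = 1 for y ∈ 𝔅_k. (1.14)  They form a subgroup of the group of all gauge transformations and we are
interested in spaces of orbits of this subgroup.  B. Gauge (Fixing) Conditions.  Generally speaking a gauge condition
is a surface in a space of gauge field configurations, intersecting each orbit at exactly one point. Usually such a
surface is given by equations F(U) = 0."*
p. 81 [PDF 7]: *"Let us take an arbitrary U′ such that U′U₀ ∈ 𝔄_k({Ω_j}, α₀) ∩ 𝔅_k(𝔅_k, V) ∩ Ax_k(𝔅_k, U₀) (1.28) and
let us consider the set {U′^{u⁻¹}} for gauge transformations u satisfying the conditions (R̄₀uʲ)(y) = 1 for y ∈ Λ_j,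
j = 0, 1, …, k. (1.29) … Let us make few remarks assuming that this statement is true. The unique gauge
transformations described in it define a mapping of the set (1.28) into the regular part of the surface (1.27). Let us
denote the image set of this mapping by Σ_k, and U′^{u⁻¹} = U₁. The set Σ_k is not contained in 𝔅_k(𝔅_k, V) because
the gauge transformations u do not satisfy the necessary conditions (1.14)."*
p. 82 [PDF 8]: *"where the configuration B is defined by the above equations. Thus we have Σ_k ⊂ {a set of
configurations U = U₁U₀, U ∈ 𝔄_k({Ω_j}, α₀), U₁ = e^{iηA}, |A| < O(α₀(Lʲη)⁻¹), |∇^η_{U₀}A| < O(α₀(Lʲη)⁻²) on Ω_j,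
Q(U₀, ηA) = B, R(U₀)D^{η*}_{U₀}A = 0}. (1.32)"* (render p008-x2; the fold owner's ledger ROWS-B8.md «Transcript notes»
B8-B11 records this display as «a description of the image set whose content is Theorem 2; no decl wanted» — only its
`𝔄_k`-clause, which is NOT a clause of Theorem 2, is typed below, and proved).

## IN TREE — THE 27 ROWS OF BLOCK 01, CITED BY NAME (never restated; `recall`ed in §4 so the kernel checks the names)

| row | display / item (page) | in-tree declaration(s) |
|---|---|---|
| B8.Eq1.1 | (1.1) covariant derivatives (76) | `B8Ineq132.covDerivFwd`, `B8Ineq132.covDeriv` (`R(U)` = `B7Eq78Linearization.conjR`) |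
| B8.Eq1.2 | (1.2) covariant divergence (76) | `B8Eq143PlaqExpansion.pdiv`, `B8Ineq132.covDiv`; V1 torus `B8Eq12HodgeLaplacianV1.dcsE_apply` |
| B8.Eq1.3 | (1.3)–(1.4) domains (77) | `B8ConstraintBonds.DomainSeq`, `B8Eq134Admissible.Admissible134`, `B8SectAStatements.MetricClause14` |
| B8.Eq1.5 | (1.5)–(1.6) `Λ_j` (77) | `B8ConstraintBonds.Lam`, `B8Ineq132.layer`, `B8Ineq132.exists_layer` |
| B8.Def§A | p. 77 bond/plaquette convention | `B8Ineq132.BondTouches`, `B8Ineq132.PlaqTouches`, `B8Eq113ClassBk.bondsOn` |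
| B8.Eq1.7 | (1.7)–(1.9) `𝔄_k({Ω_j}, α₀)` (77) | `B8Ineq132.CondAt`, `B8Ineq132.InAk`, (1.8)⇔(1.7) `B8Ineq132.threshold_18`, «enough for p, b ∈ Bʲ(Λ_j)» `B8Ineq132.inAk_of_layers` |
| B8.Eq1.10 | (1.10) Wilson form (77) | `B8SectAStatements.WilsonSmallOn`/`InAkWilson`, `B8Eq110UnitaryProof.inAkWilson_of_inAkOn_unitaryGroup` |
| B8.Eq1.11 | (1.11) + invariance of `𝔄_k` (77) | `B8Ineq132.covDeriv_gaugeAct`, `covDiv_gaugeAct`, `inAk_gaugeAct_iff`; V1 `B8Eq111SiteCovariance.covDAdj_gaugeAct` |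
| B8.Eq1.13 | (1.12)–(1.13) `𝔅_k`, `𝔅_k(𝔅_k, V)` (78) | `B8ConstraintBonds.Bk`, `B8ConstraintBonds.Constr`, `B8Eq113ClassBk.InBk` |
| B8.Eq1.14 | (1.14) + invariance sentence (78) | `B8ConstraintBonds.ResGauge`, `Invariant`, `bondsB_invariant`, `literal_not_Invariant` (G-adv8-10), `B8Eq113ClassBk.avgIter_gaugeAct_bond`, `inBkOn_gaugeAct_of_resGauge` |
| B8.Eq1.15 | (1.15) axial gauge + «determine uniquely» (78) | `B8Ineq132.InAxOne`, `B8Eq115GaugeFixing.gaugeFix_global`, `gaugeFix_unique_normalised` |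
| B8.Eq1.16 | (1.16)–(1.18) (78) | `B8Lemma1NonAbelian.pert`, `mulCfg`, `B8Eq119TwistedAxial.eq117`, `eq118` |
| B8.Eq1.19 | (1.19)–(1.20) `Ax_k(𝔅_k, U₀)` + «determine uniquely» (79) | `B8Eq119TwistedAxial.InAx`, `pert_avgIter`, `twistedFix_global`, `twistedFix_unique_normalised` |
| B8.Eq1.21 | (1.21)–(1.22) (79) | `B8Eq143PlaqExpansion.lead`, `covPlaq`, `eq121` |
| B8.Eq1.23 | (1.23) `Bʲ(c)` (79) | `B8SectAStatements.bondsBetween`, `bondsBetweenBlocks` |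
| B8.Lem1 | Lemma 1 (1.24)–(1.25) (79) | `B8.Lemma1Printed` (abstract leaf), DISCHARGED `B8Lemma1NonAbelian.lemma1Printed_blockPairNA` (also the p. 80 locality sentence: `lemma1_explicit`; interior constant `interior_bound`) |
| B8.Eq1.26 | (1.26) (79) | `B8Eq143PlaqExpansion.ineq126` |
| B8.Eq1.27 | (1.27) Landau gauge (80) | `B8Eq127LandauGauge.IsLandauBG`, `LandauBGL`; p. 80 linearisation sentence `B7Eq78Linearization.hasDerivAt_invI_smul_mlog_Rbar` |
| B8.Eq1.28 | (1.28) (81) | `B8Eq113ClassBk.Class128` |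
| B8.Eq1.29 | (1.29) (81) | `B8Eq119TwistedAxial.Restr129` (`B7Eq78Linearization.Rbar`) |
| B8.Eq1.31 | (1.30)–(1.31) (81–82) | `B8Eq131Derivation.eq84_local`, `eq130_lhs`, `eq131_interior`, `eq131_crossing`, `B8Thm2LogB.Bint`, `Bcross` |
| B8.Eq1.33 | (1.33)–(1.35) (82) | `B8Eq133Hypotheses.Hyp133to135`, p. 82 sentence `hyp135_of_inBk`; abstract `B8.GFData` (`InA`, …) |
| B8.Eq1.36 | (1.36)–(1.39) (82–83) | `B8Eq131Derivation.eq137_interior`, `B8Eq137QjEqB.Qj_eq_Bint`; abstract fields of `B8.GFData` |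
| B8.Eq1.3-3, -7-2, -12-4, -16-1.18 | V1-torus twins / abstract | `B6SectADomainsV1.Domains`, `PlaqSmallOn` (`Setup.lean`) / `B8SectAStatements.InAkOn` / `B8Eq17ClassAkV1.ClassAk`, `B8ConstraintBonds.bondsB_invariant`, `B8.GFData` |

Un-rowed displays (0.1)–(0.4) of the Introduction (pp. 75–76; the planner's residual candidates for this block,
`carve/CARVE-LIST.md` § Block 01: (0.2), (0.3), (0.4)) are SPECIAL CASES of rows above: (0.1) = the plaquette clause of
(1.7)/(1.8) at one level (`B8Ineq132.CondAt`; on the `Setup.lean` tori `PlaqSmallOn`) — cited; (0.2) = the gauge action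
(`B7Prop1Explicit.gaugeAct`, (8) of [3]; on the tori `GaugeField.gaugeAct`) — cited, and it is the action in
`OrbitRel114` below; (0.3) *"UU₀⁻¹ = e^{iηA}, |A| < O(α₀), (0.3) A is a Lie algebra valued configuration"* (p. 76
[PDF 2], render p002-x2) — typed WITH BODY as the one-line condition `IntroCond03` (§1b; the `O(α₀)` constant and the
Lie algebra `𝔤 ⊂ 𝔸` explicit; (1.16) `UU₀⁻¹ = B8Lemma1NonAbelian.pert`, `e^{iηA} = B8Eq146AExpansion.expCfg (iEta η A)`
as in (1.41)); (0.4) *"Ūᵏ = V on Ω^{(k)} = Ω ∩ Zᵈ, (0.4) where V is a fixed configuration on Ω^{(k)}"* (p. 76) = (1.13)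
at the single level `k` — typed WITH BODY as `IntroConstr04` (§1b) and IDENTIFIED with r13's `B8Eq113ClassBk.InBk` for
the one-level family (`introConstr04_iff_inBk`); its invariance sentence («invariant with respect to gauge
transformations u satisfying the restrictions u = 1 on Ω^{(k)}») is row B8.Eq1.14's (`inBkOn_gaugeAct_of_resGauge`,
with the located gap G-adv8-10 `B8ConstraintBonds.literal_not_Invariant` for one-end-point bonds) — cited, not
asserted.  The orbit decomposition sentence after (0.2) is `inAk_iff_of_orbitRel114` below.

## WHAT THIS FILE ADDS (0 sorry; every `def` has its body; the two `…Printed` statements are PROVED here)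

§1 p. 78 «They form a subgroup … we are interested in spaces of orbits of this subgroup» (no row, no decl —
   `B8ConstraintBonds.ResGauge` is a `Set`): `resGaugeSubgroup` (a `def`, no instance), `ResGaugeSubgroupPrinted` +
   `_holds`; the orbit relation of that subgroup for transformations valued in a gauge group `S ≤ G` (`OrbitRel114`,
   an equivalence; `orbitSetoid114`, the orbit space `OrbitSpace114`); p. 78 §B's notion «a gauge condition is a
   surface … intersecting each orbit at exactly one point» WITH BODY (`IsGaugeCondition114`); p. 75's «decomposed
   into a union of orbits»: `𝔄_k` is constant on orbits (`inAk_iff_of_orbitRel114`, from `B8Ineq132.inAk_gaugeAct_iff`).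
§1b (v1.1) the Introduction's (0.3), (0.4) WITH BODIES: `IntroCond03` (+ `introCond03_iff`), `IntroConstr04`
   (+ `introConstr04_iff_inBk`: (0.4) IS (1.13) `B8Eq113ClassBk.InBk` for the family `Λ_k = Ω^{(k)}`, `Λ_j = ∅ (j ≠ k)`).
§2 (1.32), the clause «U = U₁U₀, U ∈ 𝔄_k({Ω_j}, α₀)» for the elements `U₁ = U′^{u⁻¹}` of `Σ_k` (no row; r05 B8-B11):
   `Eq132ClassAkPrinted` — for every `U′` in the class (1.28) and every restricted (1.29) gauge transformation `u`
   (values in `{|u| ≤ 1, |u⁻¹| ≤ 1}`), `U₁U₀ ∈ 𝔄_k({Ω_j}, α₀)` where `U₁ = U′^{u⁻¹}` in the transformation law (1.17) —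
   PROVED (`eq132ClassAkPrinted_holds`: `U₁U₀ = (U′U₀)^{u⁻¹}`, `mul_bg_eq_gaugeAct`, and gauge invariance of `𝔄_k`).
§3 THE BUNDLE `Hyp L 𝔸 k η α₀ Ω Λ V U₀` = Lemma 1 (`B8.Lemma1Printed d (B8Lemma1NonAbelian.blockPairNA d L 𝔸)`, by name)
   ∧ §1's printed sentence for `𝔅_k` (`B8ConstraintBonds.Bk L Ω`) ∧ §2's (1.32)-clause, keyed to the consumer
   `stmt-QuantumFields-20542` (a node prover takes `(h : Hyp …)`; projections `Hyp.lemma1/resGauge/eq132`); it is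
   DISCHARGED: `hyp_holds`.
§4 the `recall` index of the table above (no declaration; the kernel checks that every cited name exists).

## HONEST SCOPE / NOT TYPED (with reasons)

* (1.32)'s remaining clauses — `U₁ = e^{iηA}` with `|A| < O(α₀(Lʲη)⁻¹)`, `|∇^η_{U₀}A| < O(α₀(Lʲη)⁻²)`,
  `R(U₀)D^{η*}_{U₀}A = 0` — are the DEFINING properties of the mapping `U′ ↦ u` («assuming that this statement is
  true», p. 81), i.e. Theorem 2's (1.36)/(1.38) (block 02, row B8.Thm2 `B8.Thm2Printed`; rows B8.Eq1.27, B8.Eq1.36),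
  and `Q(U₀, ηA) = B` is (1.30)–(1.31)/(1.37) (rows B8.Eq1.31/B8.Eq1.36: `B8Eq131Derivation.eq131_*`,
  `B8Eq137QjEqB.Qj_eq_Bint`); only the `𝔄_k`-clause is new content and it is typed here in the generality its reason
  (gauge invariance, p. 77) gives: for EVERY restricted `u`, not only Theorem 2's.
* p. 80 «each orbit in 𝔄_k ∩ 𝔅_k(𝔅_k, V) intersects the surface (1.27) at exactly one point … Unfortunately, such a
  statement may not be true» — print itself withdraws it; NOT typed (the vocabulary to state it is `IsGaugeCondition114`).
* p. 80 «if u₁, u₂ satisfy these conditions, then generally the product u₁u₂ does not» and p. 81 «Σ_k is not contained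
  in 𝔅_k(𝔅_k, V)» — "generally"-remarks, zero weight (cf. `B8ConstraintBonds.literal_not_Invariant`, G-adv8-10).
* Lemma 1's printed proof chain constants `4dα₀L⁻¹`, `4(d−1)dα₀`, `4(d−1)α₀ + α₁` (pp. 79–80): proof-internal; the
  tree's certificate `B8Lemma1NonAbelian` reaches (1.25) by a different (gauge-invariant) route and the cell's census
  G-B8-10 (`B8Lemma1Abelian.printedChain_gt`) records that the literal chain over-runs `4d²`; NOT typed as statements.
* p. 77 «M₁ … fixed in [4] … depends on d and L only», «R … a power of L»: binders of (1.4) (`Admissible134`'s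
  parameters), zero weight (READING-RULE audit v2.04).  p. 82 «this condition [(3.35)] is a consequence of the first
  one» = Prop. 6 / (1.127), block 04 (row B8.Eq1.127).
* REVISION v1.1 (same seat, 2026-08-28): APPEND-ONLY — every v1 (p607608) declaration byte-identical; adds §1b
  ((0.3)/(0.4), the planner's residual candidates of `carve/CARVE-LIST.md` § Block 01) and corrects this docstring's
  paraphrase of (0.3) to the printed «UU₀⁻¹ = e^{iηA}» (read as image, p002-x2).
* Carrier of record = the `ℤᵈ` lattices of the lineage (`B7Prop1Explicit.Site d = Fin d → ℤ`, bond fields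
  `Site d → Fin d → 𝔸ˣ`, `𝔸` a complete normed ℂ-algebra with `‖1‖ = 1`), print's «arbitrary lattice» licence p. 76;
  `Hyp` takes `𝔸 : Type` because the Lemma-1 carrier `B8.LocalData` lives in `Type`.  The orbit/subgroup notions of §1
  are stated for any group `G` of values.  No summit statement is proved by this file.
-/

noncomputable section

namespace Literature.MathematicalPhysics.QuantumFieldTheory.Balaban1983to89.B8Carve01SpacesHyp

open B7Prop1Explicit (e gaugeAct U1)
open B8ConstraintBonds (ResGauge Bk)
open B8Ineq132 (InAk inAk_gaugeAct_iff)
open B8Eq119TwistedAxial (InAx Restr129 mulCfg_pert mulCfg_eq_mul)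
open B8Eq113ClassBk (InBk Class128)
open B8Lemma1NonAbelian (pert mulCfg blockPairNA lemma1Printed_blockPairNA)
open B8Eq115GaugeFixing (gaugeAct_mul)
open B8Ineq130 (gaugeAct_one)

-- `Site` alone would resolve to the torus sites of `Setup.lean`; re-export the `ℤ^d` sites of `B7Prop1Explicit`.
export B7Prop1Explicit (Site)

variable {d : ℕ}

/-! ## §1 p. 78: the subgroup (1.14), its orbits, the notion of a gauge condition -/

section Subgroup114

variable {G : Type*} [Group G]

/-- **p. 78 [PDF 4], the subgroup (1.14)**: *"gauge transformations u satisfying the conditions u(y) = 1 for y ∈ 𝔅_k.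
(1.14)  They form a subgroup of the group of all gauge transformations"* — the set `B8ConstraintBonds.ResGauge B`
(`u = 1` on `B`, print's `B = 𝔅_k` of (1.12)) AS A SUBGROUP of the group `Site d → G` of all gauge transformations
(pointwise group structure).  A `def`, not an instance. [cite: Balaban1985RegularSpaces, (1.14) p.78] -/
def resGaugeSubgroup (G : Type*) [Group G] (B : Set (Site d)) : Subgroup (Site d → G) where
  carrier := ResGauge B
  mul_mem' := fun {g h} hg hh x hx => by
    show (g * h) x = 1
    rw [Pi.mul_apply, hg x hx, hh x hx, one_mul]
  one_mem' := fun _ _ => rfl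
  inv_mem' := fun {g} hg x hx => by
    show g⁻¹ x = 1
    rw [Pi.inv_apply, hg x hx, inv_one]

/-- Membership in the subgroup (1.14) is `u = 1` on `B`. [cite: Balaban1985RegularSpaces, (1.14) p.78] -/
theorem mem_resGaugeSubgroup_iff (B : Set (Site d)) (u : Site d → G) :
    u ∈ resGaugeSubgroup G B ↔ ∀ y ∈ B, u y = 1 :=
  Iff.rfl

/-- **p. 78 [PDF 4], verbatim: *"They form a subgroup of the group of all gauge transformations"*** — the printed
sentence in hypothesis form for the restricted transformations (1.14) `ResGauge B` with values in `G`: closed under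
`1`, products and inverses. [cite: Balaban1985RegularSpaces, p.78 (sentence after (1.14))] -/
def ResGaugeSubgroupPrinted (G : Type*) [Group G] (B : Set (Site d)) : Prop :=
  (1 : Site d → G) ∈ ResGauge B ∧
    (∀ g h : Site d → G, g ∈ ResGauge B → h ∈ ResGauge B → g * h ∈ ResGauge B) ∧
      ∀ g : Site d → G, g ∈ ResGauge B → g⁻¹ ∈ ResGauge B

/-- The p. 78 subgroup sentence holds (the subgroup is `resGaugeSubgroup`).
[cite: Balaban1985RegularSpaces, p.78 (sentence after (1.14))] -/
theorem resGaugeSubgroupPrinted_holds (G : Type*) [Group G] (B : Set (Site d)) : ResGaugeSubgroupPrinted G B :=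
  ⟨(resGaugeSubgroup G B).one_mem, fun _ _ hg hh => (resGaugeSubgroup G B).mul_mem hg hh,
    fun _ hg => (resGaugeSubgroup G B).inv_mem hg⟩

/-- **The orbits of the subgroup (1.14)** (p. 78: *"we are interested in spaces of orbits of this subgroup"*; p. 75
(0.2): *"decomposed into a union of orbits determined by the group of all gauge transformations"*, the case `B = ∅`):
`U′` lies in the orbit of `U` iff `U′ = Uᵘ` ((8) of [3], `B7Prop1Explicit.gaugeAct`) for a gauge transformation `u`
with values in the gauge group `S ≤ G` and `u = 1` on `B`. [cite: Balaban1985RegularSpaces, p.78 (sentence after (1.14)), (0.2) p.75] -/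
def OrbitRel114 (S : Subgroup G) (B : Set (Site d)) (U U' : Site d → Fin d → G) : Prop :=
  ∃ u : Site d → G, (∀ x, u x ∈ S) ∧ u ∈ ResGauge B ∧ U' = gaugeAct u U

/-- Every configuration is in its own orbit (`u = 1`). [cite: Balaban1985RegularSpaces, p.78 (sentence after (1.14))] -/
theorem orbitRel114_refl (S : Subgroup G) (B : Set (Site d)) (U : Site d → Fin d → G) : OrbitRel114 S B U U :=
  ⟨1, fun _ => S.one_mem, (resGaugeSubgroup G B).one_mem, (gaugeAct_one U).symm⟩

/-- The orbit relation is symmetric (`u ↦ u⁻¹`). [cite: Balaban1985RegularSpaces, p.78 (sentence after (1.14))] -/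
theorem orbitRel114_symm {S : Subgroup G} {B : Set (Site d)} {U U' : Site d → Fin d → G}
    (h : OrbitRel114 S B U U') : OrbitRel114 S B U' U := by
  obtain ⟨u, huS, huB, rfl⟩ := h
  refine ⟨u⁻¹, fun x => by rw [Pi.inv_apply]; exact S.inv_mem (huS x), (resGaugeSubgroup G B).inv_mem huB, ?_⟩
  rw [← gaugeAct_mul, inv_mul_cancel, gaugeAct_one]

/-- The orbit relation is transitive (`u ↦ wu`, `V^{wu} = (Vᵘ)ʷ`). [cite: Balaban1985RegularSpaces, p.78 (sentence after (1.14))] -/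
theorem orbitRel114_trans {S : Subgroup G} {B : Set (Site d)} {U U' U'' : Site d → Fin d → G}
    (h : OrbitRel114 S B U U') (h' : OrbitRel114 S B U' U'') : OrbitRel114 S B U U'' := by
  obtain ⟨u, huS, huB, rfl⟩ := h
  obtain ⟨w, hwS, hwB, rfl⟩ := h'
  refine ⟨w * u, fun x => by rw [Pi.mul_apply]; exact S.mul_mem (hwS x) (huS x),
    (resGaugeSubgroup G B).mul_mem hwB huB, ?_⟩
  rw [gaugeAct_mul]

/-- The orbit relation of the subgroup (1.14) is an equivalence relation.
[cite: Balaban1985RegularSpaces, p.78 (sentence after (1.14))] -/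
theorem orbitRel114_equivalence (S : Subgroup G) (B : Set (Site d)) : Equivalence (OrbitRel114 (d := d) S B) :=
  ⟨orbitRel114_refl S B, orbitRel114_symm, orbitRel114_trans⟩

/-- The orbit relation as a `Setoid` (a `def`, not an instance). [cite: Balaban1985RegularSpaces, p.78 (sentence after (1.14))] -/
def orbitSetoid114 (S : Subgroup G) (B : Set (Site d)) : Setoid (Site d → Fin d → G) :=
  ⟨OrbitRel114 S B, orbitRel114_equivalence S B⟩

/-- **"spaces of orbits of this subgroup"** (p. 78): the quotient of the configuration space by the orbit relation of
the subgroup (1.14). [cite: Balaban1985RegularSpaces, p.78 (sentence after (1.14))] -/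
def OrbitSpace114 (S : Subgroup G) (B : Set (Site d)) : Type _ :=
  Quotient (orbitSetoid114 (d := d) S B)

/-- Two configurations have the same image in the orbit space iff they are in one orbit.
[cite: Balaban1985RegularSpaces, p.78 (sentence after (1.14))] -/
theorem orbitSpace114_mk_eq_iff (S : Subgroup G) (B : Set (Site d)) (U U' : Site d → Fin d → G) :
    (Quotient.mk (orbitSetoid114 S B) U : OrbitSpace114 S B) = Quotient.mk (orbitSetoid114 S B) U' ↔
      OrbitRel114 S B U U' :=
  Quotient.eq (r := orbitSetoid114 S B)

/-- **p. 78 [PDF 4] §B, verbatim: *"Generally speaking a gauge condition is a surface in a space of gauge field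
configurations, intersecting each orbit at exactly one point. Usually such a surface is given by equations F(U) = 0."***
— WITH BODY: the surface `Σ` is a gauge condition for the (orbit-closed) space `𝒞` relative to the subgroup (1.14)
iff every orbit through `𝒞` meets `Σ` in exactly one configuration.  (p. 80's tentative statement «each orbit in
𝔄_k ∩ 𝔅_k(𝔅_k, V) intersects the surface (1.27) at exactly one point», which print itself withdraws — «may not be
true» —, reads `IsGaugeCondition114 S 𝔅_k (𝔄_k ∩ 𝔅_k(𝔅_k, V)) {Landau (1.27) + bounds}`; it is NOT asserted here.)
[cite: Balaban1985RegularSpaces, p.78 (§B, first paragraph)] -/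
def IsGaugeCondition114 (S : Subgroup G) (B : Set (Site d)) (𝒞 surf : Set (Site d → Fin d → G)) : Prop :=
  ∀ U ∈ 𝒞, ∃! U' : Site d → Fin d → G, U' ∈ surf ∧ OrbitRel114 S B U U'

end Subgroup114

section Orbits

variable {𝔸 : Type*} [NormedRing 𝔸] [NormOneClass 𝔸] [NormedAlgebra ℂ 𝔸] [CompleteSpace 𝔸]

omit [CompleteSpace 𝔸] in
/-- **p. 75/77: the regular space is a union of orbits** (*"invariant with respect to gauge transformations … so the
space of configurations satisfying (0.1) is decomposed into a union of orbits"*, p. 75; *"the space 𝔄_k({Ω_j}, α₀) is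
invariant with respect to gauge transformations"*, p. 77): membership in `𝔄_k({Ω_j}, α₀)` (`B8Ineq132.InAk`) is
constant on the orbits of every subgroup (1.14) for gauge groups `S ≤ {|u| ≤ 1, |u⁻¹| ≤ 1}` — from
`B8Ineq132.inAk_gaugeAct_iff`. [cite: Balaban1985RegularSpaces, p.77 (last paragraph of §A), (0.2) p.75] -/
theorem inAk_iff_of_orbitRel114 {S : Subgroup 𝔸ˣ} (hS : S ≤ U1 𝔸) {B : Set (Site d)}
    {U U' : Site d → Fin d → 𝔸ˣ} (h : OrbitRel114 S B U U') (L k : ℕ) (η α₀ : ℝ) (Ω : ℕ → Set (Site d)) :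
    InAk L k η α₀ Ω U' ↔ InAk L k η α₀ Ω U := by
  obtain ⟨u, huS, -, rfl⟩ := h
  exact inAk_gaugeAct_iff L k η α₀ Ω (fun x => hS (huS x)) U

end Orbits

/-! ## §1b (v1.1) The Introduction's displays (0.3) and (0.4), p. 76, with bodies -/

section Intro

variable {𝔸 : Type*} [NormedRing 𝔸] [NormOneClass 𝔸] [NormedAlgebra ℂ 𝔸] [CompleteSpace 𝔸]

omit [NormOneClass 𝔸] in
/-- **(0.3)** p. 76 [PDF 2], verbatim: *"if U is an intersection of an orbit satisfying (0.1) with the surface, then it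
satisfies the condition UU₀⁻¹ = e^{iηA}, |A| < O(α₀), (0.3) A is a Lie algebra valued configuration."* — the
condition on the pair `(U₀, U)` WITH BODY, the `O(α₀)` constant `C` and the Lie algebra `𝔤 ⊂ 𝔸` explicit: there is a
`𝔤`-valued bond field `A` with `|A_b| < Cα₀` and `UU₀⁻¹ = e^{iηA}` bondwise ((1.16) `UU₀⁻¹ = B8Lemma1NonAbelian.pert U U₀`;
`e^{iηA} = B8Eq146AExpansion.expCfg (iEta η A)`, the (1.41) letters).  A condition, not a claim: the Introduction's
schematic form of Theorem 2's (1.36) (row B8.Eq1.36). [cite: Balaban1985RegularSpaces, (0.3) p.76] -/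
def IntroCond03 (𝔤 : Set 𝔸) (C η α₀ : ℝ) (U₀ U : Site d → Fin d → 𝔸ˣ) : Prop :=
  ∃ A : Site d → Fin d → 𝔸, (∀ x κ, A x κ ∈ 𝔤) ∧ (∀ x κ, ‖A x κ‖ < C * α₀) ∧
    pert U U₀ = B8Eq146AExpansion.expCfg (B8Eq146AExpansion.iEta η A)

omit [NormOneClass 𝔸] in
/-- Unfolding of (0.3). [cite: Balaban1985RegularSpaces, (0.3) p.76] -/
theorem introCond03_iff (𝔤 : Set 𝔸) (C η α₀ : ℝ) (U₀ U : Site d → Fin d → 𝔸ˣ) :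
    IntroCond03 𝔤 C η α₀ U₀ U ↔
      ∃ A : Site d → Fin d → 𝔸, (∀ x κ, A x κ ∈ 𝔤) ∧ (∀ x κ, ‖A x κ‖ < C * α₀) ∧
        pert U U₀ = B8Eq146AExpansion.expCfg (B8Eq146AExpansion.iEta η A) :=
  Iff.rfl

omit [NormOneClass 𝔸] in
/-- **(0.4)** p. 76 [PDF 2], verbatim: *"An example of such restrictions, appearing naturally in the variational
problem, is given by averaging operations Ūᵏ = V on Ω^{(k)} = Ω ∩ Zᵈ, (0.4) where V is a fixed configuration on
Ω^{(k)}."* — WITH BODY on the `ℤᵈ` carrier with print's averages `Ūᵏ = B7Prop2Explicit.avgIter L U k` ((43) of [3])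
and the p. 77 bond convention («at least one end-point» in `Ω^{(k)}`, level-`k` coordinates): the single-level case of
(1.13) (row B8.Eq1.13, `B8Eq113ClassBk.InBk`; identification `introConstr04_iff_inBk`).  Its invariance sentence
(«invariant with respect to gauge transformations u satisfying the restrictions u = 1 on Ω^{(k)}») is row B8.Eq1.14's
(`B8Eq113ClassBk.inBkOn_gaugeAct_of_resGauge`, located gap G-adv8-10) and is not asserted here.
[cite: Balaban1985RegularSpaces, (0.4) p.76] -/
def IntroConstr04 (L k : ℕ) (Ωk : Set (Site d)) (V U : Site d → Fin d → 𝔸ˣ) : Prop :=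
  ∀ (y : Site d) (κ : Fin d), (y ∈ Ωk ∨ y + e κ ∈ Ωk) → B7Prop2Explicit.avgIter L U k y κ = V y κ

omit [NormOneClass 𝔸] in
/-- **(0.4) IS (1.13) at the single level `k`**: `IntroConstr04 L k Ω^{(k)} V U ↔ U ∈ 𝔅_k(𝔅_k, V)`
(`B8Eq113ClassBk.InBk`) for the constraint family `Λ_k = Ω^{(k)}`, `Λ_j = ∅` (`j ≠ k`), prescribed values `V` at level
`k`. [cite: Balaban1985RegularSpaces, (0.4) p.76, (1.13) p.78] -/
theorem introConstr04_iff_inBk (L k : ℕ) (Ωk : Set (Site d)) (V U : Site d → Fin d → 𝔸ˣ) :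
    IntroConstr04 L k Ωk V U ↔ InBk L k (fun j => if j = k then Ωk else ∅) (fun _ => V) U := by
  constructor
  · intro h j hj y κ hc
    by_cases hjk : j = k
    · subst hjk
      have hc' : y ∈ Ωk ∨ y + e κ ∈ Ωk := by simpa [B8Eq113ClassBk.bondsOn] using hc
      exact h y κ hc'
    · exfalso
      simp [B8Eq113ClassBk.bondsOn, hjk] at hc
  · intro h y κ hyk
    exact h k le_rfl y κ (by simp [B8Eq113ClassBk.bondsOn, hyk])

end Intro

/-! ## §2 (1.32): the `𝔄_k`-clause of the image set `Σ_k` -/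

section Sigma132

variable {𝔸 : Type*} [NormedRing 𝔸] [NormOneClass 𝔸] [NormedAlgebra ℂ 𝔸] [CompleteSpace 𝔸]

omit [NormOneClass 𝔸] [NormedAlgebra ℂ 𝔸] [CompleteSpace 𝔸] in
/-- `U₁U₀ = (U′U₀)^{u⁻¹}` for `U₁ = U′^{u⁻¹}` in the transformation law (1.17) (`U′ᵘ := (U′U₀)ᵘU₀⁻¹`,
`B8Eq119TwistedAxial.eq117`; `= B7Eq92Concrete.mgauge U₀ u⁻¹ U′`, `B8Eq131Derivation.eq117_eq_mgauge`) — the identity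
behind "U = U₁U₀" in (1.32). [cite: Balaban1985RegularSpaces, (1.16)-(1.17) p.78, (1.32) p.82] -/
theorem mul_bg_eq_gaugeAct (u : Site d → 𝔸ˣ) (U' U₀ : Site d → Fin d → 𝔸ˣ) :
    pert (gaugeAct u⁻¹ (U' * U₀)) U₀ * U₀ = gaugeAct u⁻¹ (U' * U₀) := by
  rw [← mulCfg_eq_mul (pert _ _) U₀]
  exact mulCfg_pert _ _

/-- **(1.32), the `𝔄_k`-clause** p. 82 [PDF 8]: *"Σ_k ⊂ {a set of configurations U = U₁U₀, U ∈ 𝔄_k({Ω_j}, α₀), U₁ =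
e^{iηA}, … }. (1.32)"*, where (p. 81) `Σ_k` is the image of the class (1.28) under `U′ ↦ U₁ = U′^{u⁻¹}`, `u` the
restricted ((1.29)) gauge transformation of the statement — IN HYPOTHESIS FORM on the `ℤᵈ` carrier of record, in the
generality of its reason (gauge invariance of `𝔄_k`, p. 77): for every `U′` with `U′U₀` in the class (1.28)
(`B8Eq113ClassBk.Class128`) and every gauge transformation `u` with values in `{|u| ≤ 1, |u⁻¹| ≤ 1}` satisfying (1.29)
(`B8Eq119TwistedAxial.Restr129`), the configuration `U = U₁U₀`, `U₁ = U′^{u⁻¹}` ((1.17): `(U′U₀)^{u⁻¹}U₀⁻¹`,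
`B8Lemma1NonAbelian.pert`), lies in `𝔄_k({Ω_j}, α₀)` (`B8Ineq132.InAk`).  The other clauses of (1.32) are Theorem 2's
(1.36)/(1.38) and (1.31)/(1.37) (module docstring, HONEST SCOPE). [cite: Balaban1985RegularSpaces, (1.32) p.82] -/
def Eq132ClassAkPrinted (L k : ℕ) (η α₀ : ℝ) (Ω Λ : ℕ → Set (Site d)) (V : ℕ → Site d → Fin d → 𝔸ˣ)
    (U₀ : Site d → Fin d → 𝔸ˣ) : Prop :=
  ∀ (U' : Site d → Fin d → 𝔸ˣ) (u : Site d → 𝔸ˣ), Class128 L k η α₀ Ω Λ V U₀ U' → (∀ x, u x ∈ U1 𝔸) →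
    Restr129 L k Λ U₀ u → InAk L k η α₀ Ω (pert (gaugeAct u⁻¹ (U' * U₀)) U₀ * U₀)

/-- Unfolding of `Eq132ClassAkPrinted`. [cite: Balaban1985RegularSpaces, (1.32) p.82] -/
theorem eq132ClassAkPrinted_iff (L k : ℕ) (η α₀ : ℝ) (Ω Λ : ℕ → Set (Site d)) (V : ℕ → Site d → Fin d → 𝔸ˣ)
    (U₀ : Site d → Fin d → 𝔸ˣ) :
    Eq132ClassAkPrinted L k η α₀ Ω Λ V U₀ ↔
      ∀ (U' : Site d → Fin d → 𝔸ˣ) (u : Site d → 𝔸ˣ), Class128 L k η α₀ Ω Λ V U₀ U' → (∀ x, u x ∈ U1 𝔸) →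
        Restr129 L k Λ U₀ u → InAk L k η α₀ Ω (pert (gaugeAct u⁻¹ (U' * U₀)) U₀ * U₀) :=
  Iff.rfl

/-- **(1.32)'s `𝔄_k`-clause HOLDS** — `U₁U₀ = (U′U₀)^{u⁻¹}` (`mul_bg_eq_gaugeAct`), `U′U₀ ∈ 𝔄_k({Ω_j}, α₀)` by (1.28)
(`Class128.inAk`), and `𝔄_k` is gauge invariant (p. 77, `B8Ineq132.inAk_gaugeAct_iff`; `u⁻¹` has values in
`{|u| ≤ 1, |u⁻¹| ≤ 1}` with `u`); the restriction (1.29) is not needed. [cite: Balaban1985RegularSpaces, (1.32) p.82, p.77 (last paragraph of §A)] -/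
theorem eq132ClassAkPrinted_holds (L k : ℕ) (η α₀ : ℝ) (Ω Λ : ℕ → Set (Site d)) (V : ℕ → Site d → Fin d → 𝔸ˣ)
    (U₀ : Site d → Fin d → 𝔸ˣ) : Eq132ClassAkPrinted L k η α₀ Ω Λ V U₀ := by
  intro U' u h128 hu _
  rw [mul_bg_eq_gaugeAct]
  have hu' : ∀ x, u⁻¹ x ∈ U1 𝔸 := fun x => by
    rw [Pi.inv_apply]
    exact (U1 𝔸).inv_mem (hu x)
  exact (inAk_gaugeAct_iff L k η α₀ Ω hu' (U' * U₀)).2 h128.inAk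

end Sigma132

/-! ## §3 The bundle keyed to the consumer `stmt-QuantumFields-20542` -/

section Bundle

/-- **THE BLOCK-01 BUNDLE** (carve rule 5): the printed ASSERTIONS of B8 pp. 75–82 that carry a `Prop` name, conjoined
BY NAME on the `ℤᵈ` carrier of record for a datum `(L, 𝔸, k, η, α₀, {Ω_j}, {Λ_j}, V, U₀)` of Sects. A–C —
(i) **Lemma 1** (1.24) ⇒ (1.25) p. 79 as the tree's leaf `B8.Lemma1Printed` at the non-abelian block-pair carriers
`B8Lemma1NonAbelian.blockPairNA d L 𝔸` (row B8.Lem1); (ii) p. 78 «They form a subgroup …» for `𝔅_k`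
(`B8ConstraintBonds.Bk L Ω`, (1.12), fine coordinates) and `𝔸ˣ`-valued transformations (`ResGaugeSubgroupPrinted`);
(iii) (1.32)'s `𝔄_k`-clause (`Eq132ClassAkPrinted`).  Every other printed assertion of the section is a THEOREM in the
tree (module docstring table) and is used directly, not assumed.  Keyed to `stmt-QuantumFields-20542` (K1⁷, lane N05
[B8]); also feeds `stmt-QuantumFields-19200`.  A node prover may take `(h : Hyp L 𝔸 k η α₀ Ω Λ V U₀)`; the bundle is
discharged below (`hyp_holds`).  `Λ` (level coordinates, the argument of `Class128`/`InAx`/`Restr129`) is kept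
independent of `Ω` as in `B8Eq113ClassBk.Class128`. [cite: Balaban1985RegularSpaces, Lemma 1 p.79, (1.14) p.78, (1.32) p.82] -/
def Hyp (L : ℕ) (𝔸 : Type) [NormedRing 𝔸] [NormOneClass 𝔸] [NormedAlgebra ℂ 𝔸] [CompleteSpace 𝔸] (k : ℕ)
    (η α₀ : ℝ) (Ω Λ : ℕ → Set (Site d)) (V : ℕ → Site d → Fin d → 𝔸ˣ) (U₀ : Site d → Fin d → 𝔸ˣ) : Prop :=
  B8.Lemma1Printed d (blockPairNA d L 𝔸) ∧ ResGaugeSubgroupPrinted 𝔸ˣ (Bk L Ω) ∧ Eq132ClassAkPrinted L k η α₀ Ω Λ V U₀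

/-- **The bundle is discharged**: Lemma 1 by the tree's non-abelian certificate
`B8Lemma1NonAbelian.lemma1Printed_blockPairNA` (`c = 1/(6(d+1))`), the two residual sentences by §1–§2.
[cite: Balaban1985RegularSpaces, Lemma 1 p.79, (1.14) p.78, (1.32) p.82] -/
theorem hyp_holds (L : ℕ) (𝔸 : Type) [NormedRing 𝔸] [NormOneClass 𝔸] [NormedAlgebra ℂ 𝔸] [CompleteSpace 𝔸]
    (k : ℕ) (η α₀ : ℝ) (Ω Λ : ℕ → Set (Site d)) (V : ℕ → Site d → Fin d → 𝔸ˣ) (U₀ : Site d → Fin d → 𝔸ˣ) :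
    Hyp L 𝔸 k η α₀ Ω Λ V U₀ :=
  ⟨lemma1Printed_blockPairNA d L 𝔸, resGaugeSubgroupPrinted_holds 𝔸ˣ (Bk L Ω),
    eq132ClassAkPrinted_holds L k η α₀ Ω Λ V U₀⟩

variable {L : ℕ} {𝔸 : Type} [NormedRing 𝔸] [NormOneClass 𝔸] [NormedAlgebra ℂ 𝔸] [CompleteSpace 𝔸] {k : ℕ}
  {η α₀ : ℝ} {Ω Λ : ℕ → Set (Site d)} {V : ℕ → Site d → Fin d → 𝔸ˣ} {U₀ : Site d → Fin d → 𝔸ˣ}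

/-- Projection: Lemma 1 (row B8.Lem1, `B8.Lemma1Printed` at `blockPairNA`). [cite: Balaban1985RegularSpaces, Lemma 1 (1.25) p.79] -/
theorem Hyp.lemma1 (h : Hyp L 𝔸 k η α₀ Ω Λ V U₀) : B8.Lemma1Printed d (blockPairNA d L 𝔸) :=
  h.1

/-- Projection: the p. 78 subgroup sentence for `𝔅_k`. [cite: Balaban1985RegularSpaces, p.78 (sentence after (1.14))] -/
theorem Hyp.resGauge (h : Hyp L 𝔸 k η α₀ Ω Λ V U₀) : ResGaugeSubgroupPrinted 𝔸ˣ (Bk L Ω) :=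
  h.2.1

/-- Projection: (1.32)'s `𝔄_k`-clause. [cite: Balaban1985RegularSpaces, (1.32) p.82] -/
theorem Hyp.eq132 (h : Hyp L 𝔸 k η α₀ Ω Λ V U₀) : Eq132ClassAkPrinted L k η α₀ Ω Λ V U₀ :=
  h.2.2


end Bundle

end Literature.MathematicalPhysics.QuantumFieldTheory.Balaban1983to89.B8Carve01SpacesHyp

/-! ## §4 Machine-checked index of the in-tree declarations cited for the 27 rows of block 01

`recall` (Mathlib) only resolves each constant; nothing is declared.  One primary declaration per row (the further
names of the module-docstring table live in the same modules). -/

namespace Literature.MathematicalPhysics.QuantumFieldTheory.Balaban1983to89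

recall B8Ineq132.covDerivFwd                                  -- B8.Eq1.1
recall B8Eq143PlaqExpansion.pdiv                              -- B8.Eq1.2
recall B8ConstraintBonds.DomainSeq                            -- B8.Eq1.3
recall B8Eq134Admissible.Admissible134                        -- B8.Eq1.3 (1.4)
recall B8ConstraintBonds.Lam                                  -- B8.Eq1.5
recall B8Ineq132.BondTouches                                  -- B8.Def§A
recall B8Ineq132.CondAt                                       -- B8.Eq1.7
recall B8Ineq132.inAk_of_layers                               -- B8.Eq1.7 (p. 77 remark)
recall B8Eq110UnitaryProof.inAkWilson_of_inAkOn_unitaryGroup  -- B8.Eq1.10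
recall B8Ineq132.covDeriv_gaugeAct                            -- B8.Eq1.11
recall B8Ineq132.inAk_gaugeAct_iff                            -- B8.Eq1.11 (invariance of 𝔄_k)
recall B8ConstraintBonds.Bk                                   -- B8.Eq1.13
recall B8Eq113ClassBk.InBk                                    -- B8.Eq1.13
recall B8ConstraintBonds.ResGauge                             -- B8.Eq1.14
recall B8Eq113ClassBk.inBkOn_gaugeAct_of_resGauge             -- B8.Eq1.14 (invariance sentence)
recall B8Ineq132.InAxOne                                      -- B8.Eq1.15
recall B8Eq115GaugeFixing.gaugeFix_unique_normalised          -- B8.Eq1.15 («determine uniquely»)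
recall B8Lemma1NonAbelian.pert                                -- B8.Eq1.16
recall B8Eq119TwistedAxial.eq117                              -- B8.Eq1.16 (1.17)
recall B8Eq119TwistedAxial.InAx                               -- B8.Eq1.19
recall B8Eq119TwistedAxial.twistedFix_unique_normalised       -- B8.Eq1.19 («determine uniquely»)
recall B8Eq143PlaqExpansion.lead                              -- B8.Eq1.21
recall B8Eq143PlaqExpansion.eq121                             -- B8.Eq1.21
recall B8SectAStatements.bondsBetween                         -- B8.Eq1.23
recall B8.Lemma1Printed                                       -- B8.Lem1 (leaf)
recall B8Lemma1NonAbelian.lemma1Printed_blockPairNA           -- B8.Lem1 (discharged)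
recall B8Lemma1NonAbelian.lemma1_explicit                     -- B8.Lem1 (p. 80 locality)
recall B8Eq143PlaqExpansion.ineq126                           -- B8.Eq1.26
recall B8Eq127LandauGauge.IsLandauBG                          -- B8.Eq1.27
recall B7Eq78Linearization.hasDerivAt_invI_smul_mlog_Rbar     -- p. 80 linearisation sentence
recall B8Eq113ClassBk.Class128                                -- B8.Eq1.28
recall B8Eq119TwistedAxial.Restr129                           -- B8.Eq1.29
recall B8Eq131Derivation.eq84_local                           -- B8.Eq1.31
recall B8Eq131Derivation.eq131_interior                       -- B8.Eq1.31
recall B8Eq133Hypotheses.Hyp133to135                          -- B8.Eq1.33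
recall B8Eq133Hypotheses.hyp135_of_inBk                       -- B8.Eq1.33 (p. 82 sentence)
recall B8.GFData                                              -- B8.Eq1.33 / B8.Eq1.36 (abstract), B8.Eq1.16-1.18
recall B8Eq131Derivation.eq137_interior                       -- B8.Eq1.36
recall B8Eq137QjEqB.Qj_eq_Bint                                -- B8.Eq1.36 (Q_j(U₀, ηA) = B)
recall B6SectADomainsV1.Domains                               -- B8.Eq1.3-3 (V1 torus)
recall PlaqSmallOn                                            -- B8.Eq1.7-2 (Setup torus)
recall B8ConstraintBonds.bondsB_invariant                     -- B8.Eq1.12-4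

end Literature.MathematicalPhysics.QuantumFieldTheory.Balaban1983to89

end
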